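import Mathlib
import Summits.Ventures.PercRepro2.Defs
import Summits.Ventures.PercRepro2.Independence
import Summits.Ventures.PercRepro2.Harris
import Summits.Ventures.PercRepro2.Graph
import Summits.Ventures.PercRepro2.Exploration
import Summits.Ventures.PercRepro2.Events
import Summits.Ventures.PercRepro2.FourFunctions
import Summits.Ventures.PercRepro2.Induced
import Summits.Ventures.PercRepro2.Frontier
import Summits.Ventures.PercRepro2.ObsIndependence
import Summits.Ventures.PercRepro2.BHK
import Summits.Ventures.PercRepro2.BHKEvents
import Summits.Ventures.PercRepro2.SideAgreement
import Summits.Ventures.PercRepro2.VdBKahn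
import Summits.Ventures.PercRepro2.BHKAvoid
import Summits.Ventures.PercRepro2.R2PrimeThreeReduction
import Summits.Ventures.PercRepro2.YBridge
import Summits.Ventures.PercRepro2.Yu1Functionals
import Summits.Ventures.PercRepro2.Yu1Events
import Summits.Ventures.PercRepro2.Yu1
import Summits.Ventures.PercRepro2.LBSplit
import Summits.Ventures.PercRepro2.YDelta
import Summits.Ventures.PercRepro2.SD
import Summits.Ventures.PercRepro2.Threshold
import Summits.Ventures.PercRepro2.Lambda
import Summits.Ventures.PercRepro2.LambdaTau
import Summits.Ventures.PercRepro2.LambdaSlack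
import Summits.Ventures.PercRepro2.HF2
import Summits.Ventures.PercRepro2.Yu2
import Summits.Ventures.PercRepro2.N0
import Summits.Ventures.PercRepro2.Y
import Summits.Ventures.PercRepro2.YDeltaTools
import Summits.Ventures.PercRepro2.ZDelta
import Summits.Ventures.PercRepro2.ZExpand
import Summits.Ventures.PercRepro2.ISplit
import Summits.Ventures.PercRepro2.MRl
import Summits.Ventures.PercRepro2.ZOloc
import Summits.Ventures.PercRepro2.SideBridge
import Summits.Ventures.PercRepro2.HCov
import Summits.Ventures.PercRepro2.BasePrime
import Summits.Ventures.PercRepro2.BasePendant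

/-!
# (HCOV) at a pendant `a₃` attached to a root: the first `a₃`-dependent theorem of the (HCOV) line
(blind cell PercRepro2, typer-1; mine-a g2 `MINEA-LOCALSUPER.md` §13 FACT C, INBOX 2026-08-23T09:38:10Z;
lead g11 ASSIGNMENTS v11.8 (3))

Let `a₃` be a LEAF attached to the root `a₂` by the single edge `f` of weight `q = p f`, and let
`o, b, a₁ ≠ a₃`. Every event of `Gc` that does not mention `a₃` ("`a₃`-free": `Q = {a₁ ↮ a₂}`,
`{v ∈ C(a_i)}` for `v ∈ {o, b}`) is independent of `f`, while `{a₃ ∈ C(a₂)} = {f open}`,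
`{a₃ ∈ C(a₁)} = {f open} ∩ {a₁ ↔ a₂}`; hence `PD = Q ∩ {f closed}`, `T = Q ∩ {f open}`, `T′ = ∅`
(`PDEvent_pendant`, `TEvent_pendant`, `TEvent'_pendant`) and every atom of `Gc` is a multiple `q`,
`1 − q` or `0` of an `a₃`-free mass (`prob_PD_inter`, `prob_T_inter`, `prob_T'_inter`).

* **`Gc_pendant_root`** (mine-a's identity, 120 / 120 exact checks):
  `Gc = (1 − q) · P(Q) · [2q · C(oL, bL) − 2(1 − q) · C(oH, bL) − 2 · C(oL, bH)]` with the cleared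
  covariances `C(X, Y) = P(Q) P(Q, X, Y) − P(Q, X) P(Q, Y)` under `Q`;
* `covC_same_nonneg` (BHK same cluster, `bhk_same_cluster_events`) and `covC_cross_nonpos`
  (BHK 1.3 cross cluster, `bhk_cross_cluster`) give the signs, hence
  **`HCov_pendant_root`**: (HCOV) holds at every labelled instance whose `a₃` is a leaf at `a₂`.
-/

namespace Summit.Ventures.PercRepro2

open UnionCluster CovForm

namespace PendantRoot

variable {V : Type*} {E : Type*} [Fintype E] [DecidableEq E] {R : Type*} [Field R]
  [LinearOrder R] [IsStrictOrderedRing R]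

/-! ## The pendant edge and the `a₃`-free events -/

section Events

variable {ends : E → Sym2 V} {f : E} {a₃ a₂ : V}

omit [Fintype E] [DecidableEq E] in
/-- An event not mentioning `a₃` is determined by the edges other than `f`. -/
def Free (f : E) (A : Set (Config E)) : Prop := DependsOn (· ∈ A) ({f}ᶜ : Set E)

omit [Fintype E] [DecidableEq E] in
/-- A connection between two non-leaf vertices does not depend on the leaf edge. -/
lemma free_connEvent (hf : ends f = s(a₃, a₂)) (hleaf : ∀ e, a₃ ∈ ends e → e = f) (h32 : a₃ ≠ a₂)
    {x y : V} (hx : x ≠ a₃) (hy : y ≠ a₃) : Free f (connEvent ends x y) := by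
  intro ω ω' hagree
  have h : ∀ e, e ≠ f → ω e = ω' e := fun e he => hagree e he
  exact propext ⟨conn_of_conn_of_eq_off_leaf hf hleaf h32 h hx hy,
    conn_of_conn_of_eq_off_leaf hf hleaf h32 (fun e he => (h e he).symm) hx hy⟩

omit [Fintype E] [DecidableEq E] in
/-- Free events are closed under intersection. -/
lemma Free.inter {A B : Set (Config E)} (hA : Free f A) (hB : Free f B) : Free f (A ∩ B) := by
  have := dependsOn_inter hA hB
  rwa [Set.union_self] at this

omit [Fintype E] [DecidableEq E] in
/-- Free events are closed under complement. -/
lemma Free.compl {A : Set (Config E)} (hA : Free f A) : Free f Aᶜ := dependsOn_compl hA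

omit [Fintype E] [DecidableEq E] in
/-- `Q = {a₁ ↮ a₂}` as a complement. -/
lemma avoidAll_eq_compl (ends : E → Sym2 V) (a₁ a₂ : V) :
    avoidAll ends a₂ {a₁} = (connEvent ends a₁ a₂)ᶜ := by
  ext ω
  simp only [avoidAll, Set.mem_setOf_eq, Finset.mem_singleton, forall_eq, Set.mem_compl_iff,
    connEvent]
  exact ⟨fun h hc => h (conn_symm hc), fun h hc => h (conn_symm hc)⟩

omit [Fintype E] [DecidableEq E] in
/-- `Q` is free when `a₁ ≠ a₃`. -/
lemma free_avoidAll (hf : ends f = s(a₃, a₂)) (hleaf : ∀ e, a₃ ∈ ends e → e = f) (h32 : a₃ ≠ a₂)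
    {a₁ : V} (h31 : a₃ ≠ a₁) : Free f (avoidAll ends a₂ {a₁}) := by
  rw [avoidAll_eq_compl]
  exact (free_connEvent hf hleaf h32 (Ne.symm h31) (Ne.symm h32)).compl

omit [Fintype E] [DecidableEq E] in
/-- `{a₂ ↔ a₃} = {f open}`. -/
lemma connEvent_root_leaf (hf : ends f = s(a₃, a₂)) (hleaf : ∀ e, a₃ ∈ ends e → e = f)
    (h32 : a₃ ≠ a₂) : connEvent ends a₂ a₃ = openEdge f := by
  ext ω
  simp only [connEvent, Set.mem_setOf_eq, openEdge]
  constructor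
  · intro hc
    by_contra hωf
    have hωf' : ω f = false := by cases h : ω f <;> simp_all
    exact h32 (conn_leaf_closed hf hleaf h32 hωf' (conn_symm hc)).symm
  · intro hωf
    exact conn_symm (conn_of_openAdj ⟨f, hωf, hf⟩)

omit [Fintype E] [DecidableEq E] in
/-- `{a₁ ↔ a₃} = {f open} ∩ {a₁ ↔ a₂}` for `a₁ ≠ a₃`. -/
lemma connEvent_other_leaf (hf : ends f = s(a₃, a₂)) (hleaf : ∀ e, a₃ ∈ ends e → e = f)
    (h32 : a₃ ≠ a₂) {a₁ : V} (h31 : a₃ ≠ a₁) :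
    connEvent ends a₁ a₃ = openEdge f ∩ connEvent ends a₁ a₂ := by
  ext ω
  simp only [connEvent, Set.mem_setOf_eq, openEdge, Set.mem_inter_iff]
  constructor
  · intro hc
    have hωf : ω f = true := by
      by_contra hωf
      have hωf' : ω f = false := by cases h : ω f <;> simp_all
      exact h31 (conn_leaf_closed hf hleaf h32 hωf' (conn_symm hc)).symm
    exact ⟨hωf, conn_symm ((conn_leaf_open hf hωf).1 (conn_symm hc))⟩
  · rintro ⟨hωf, hc⟩
    exact conn_trans hc (conn_symm (conn_of_openAdj ⟨f, hωf, hf⟩))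

omit [Fintype E] [DecidableEq E] in
/-- `PD = Q ∩ {f closed}`. -/
lemma PDEvent_pendant (hf : ends f = s(a₃, a₂)) (hleaf : ∀ e, a₃ ∈ ends e → e = f)
    (h32 : a₃ ≠ a₂) {a₁ : V} (h31 : a₃ ≠ a₁) :
    PDEvent ends a₁ a₂ a₃ = avoidAll ends a₂ {a₁} ∩ closedEdge f := by
  unfold PDEvent Dtilde inU
  rw [avoidAll_eq_compl, closedEdge_eq_compl]
  congr 2
  ext ω
  simp only [Set.mem_union, connEvent, Set.mem_setOf_eq, openEdge]
  constructor
  · rintro (h | h)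
    · have h' : ω ∈ connEvent ends a₁ a₃ := conn_symm h
      rw [connEvent_other_leaf hf hleaf h32 h31] at h'
      exact h'.1
    · have h' : ω ∈ connEvent ends a₂ a₃ := conn_symm h
      rw [connEvent_root_leaf hf hleaf h32] at h'
      exact h'
  · intro hωf
    exact Or.inr (conn_of_openAdj ⟨f, hωf, hf⟩)

omit [Fintype E] [DecidableEq E] in
/-- `T = Q ∩ {f open}`. -/
lemma TEvent_pendant (hf : ends f = s(a₃, a₂)) (hleaf : ∀ e, a₃ ∈ ends e → e = f)
    (h32 : a₃ ≠ a₂) (a₁ : V) :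
    TEvent ends a₁ a₂ a₃ = avoidAll ends a₂ {a₁} ∩ openEdge f := by
  unfold TEvent
  rw [connEvent_root_leaf hf hleaf h32]
  congr 1
  ext ω
  simp only [Set.mem_compl_iff, connEvent, Set.mem_setOf_eq, avoidAll, Finset.mem_singleton,
    forall_eq]

omit [Fintype E] [DecidableEq E] in
/-- `T′ = ∅`. -/
lemma TEvent'_pendant (hf : ends f = s(a₃, a₂)) (hleaf : ∀ e, a₃ ∈ ends e → e = f)
    (h32 : a₃ ≠ a₂) {a₁ : V} (h31 : a₃ ≠ a₁) : TEvent ends a₂ a₁ a₃ = ∅ := by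
  unfold TEvent
  rw [connEvent_other_leaf hf hleaf h32 h31]
  ext ω
  simp only [Set.mem_inter_iff, Set.mem_compl_iff, Set.mem_empty_iff_false, iff_false, not_and]
  intro h _ hc
  exact h hc

end Events

/-! ## The atoms of `Gc` at a pendant root -/

section Atoms

variable {ends : E → Sym2 V} {f : E} {a₃ a₂ : V} (p : E → R)

omit [LinearOrder R] [IsStrictOrderedRing R] in
/-- A free event is independent of `{f open}`. -/
lemma prob_inter_openEdge_of_free {A : Set (Config E)} (hA : Free f A) :
    prob p (A ∩ openEdge f) = prob p A * p f := by
  rw [prob_inter_eq_mul_of_dependsOn p (F₁ := ({f}ᶜ : Set E)) (F₂ := {f}) disjoint_compl_left hA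
    (dependsOn_openEdge f), prob_openEdge]

omit [LinearOrder R] [IsStrictOrderedRing R] in
/-- A free event is independent of `{f closed}`. -/
lemma prob_inter_closedEdge_of_free {A : Set (Config E)} (hA : Free f A) :
    prob p (A ∩ closedEdge f) = prob p A * (1 - p f) := by
  rw [prob_inter_eq_mul_of_dependsOn p (F₁ := ({f}ᶜ : Set E)) (F₂ := {f}) disjoint_compl_left hA
    (dependsOn_closedEdge f), closedEdge_eq_compl, prob_compl, prob_openEdge]

omit [LinearOrder R] [IsStrictOrderedRing R] in
/-- `P(PD ∩ X) = (1 − q) P(Q ∩ X)` for free `X`. -/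
lemma prob_PD_inter (hf : ends f = s(a₃, a₂)) (hleaf : ∀ e, a₃ ∈ ends e → e = f) (h32 : a₃ ≠ a₂)
    {a₁ : V} (h31 : a₃ ≠ a₁) {X : Set (Config E)} (hX : Free f X) :
    prob p (PDEvent ends a₁ a₂ a₃ ∩ X) = (1 - p f) * prob p (avoidAll ends a₂ {a₁} ∩ X) := by
  rw [PDEvent_pendant hf hleaf h32 h31, Set.inter_right_comm,
    prob_inter_closedEdge_of_free p ((free_avoidAll hf hleaf h32 h31).inter hX), mul_comm]

omit [LinearOrder R] [IsStrictOrderedRing R] in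
/-- `P(PD) = (1 − q) P(Q)`. -/
lemma prob_PD (hf : ends f = s(a₃, a₂)) (hleaf : ∀ e, a₃ ∈ ends e → e = f) (h32 : a₃ ≠ a₂)
    {a₁ : V} (h31 : a₃ ≠ a₁) :
    prob p (PDEvent ends a₁ a₂ a₃) = (1 - p f) * prob p (avoidAll ends a₂ {a₁}) := by
  rw [PDEvent_pendant hf hleaf h32 h31,
    prob_inter_closedEdge_of_free p (free_avoidAll hf hleaf h32 h31), mul_comm]

omit [LinearOrder R] [IsStrictOrderedRing R] in
/-- `P(T ∩ X) = q P(Q ∩ X)` for free `X`. -/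
lemma prob_T_inter (hf : ends f = s(a₃, a₂)) (hleaf : ∀ e, a₃ ∈ ends e → e = f) (h32 : a₃ ≠ a₂)
    {a₁ : V} (h31 : a₃ ≠ a₁) {X : Set (Config E)} (hX : Free f X) :
    prob p (TEvent ends a₁ a₂ a₃ ∩ X) = p f * prob p (avoidAll ends a₂ {a₁} ∩ X) := by
  rw [TEvent_pendant hf hleaf h32 a₁, Set.inter_right_comm,
    prob_inter_openEdge_of_free p ((free_avoidAll hf hleaf h32 h31).inter hX), mul_comm]

omit [LinearOrder R] [IsStrictOrderedRing R] in
/-- `P(T) = q P(Q)`. -/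
lemma prob_T (hf : ends f = s(a₃, a₂)) (hleaf : ∀ e, a₃ ∈ ends e → e = f) (h32 : a₃ ≠ a₂)
    {a₁ : V} (h31 : a₃ ≠ a₁) :
    prob p (TEvent ends a₁ a₂ a₃) = p f * prob p (avoidAll ends a₂ {a₁}) := by
  rw [TEvent_pendant hf hleaf h32 a₁, prob_inter_openEdge_of_free p (free_avoidAll hf hleaf h32 h31),
    mul_comm]

omit [LinearOrder R] [IsStrictOrderedRing R] in
/-- `P(T′ ∩ X) = 0`. -/
lemma prob_T'_inter (hf : ends f = s(a₃, a₂)) (hleaf : ∀ e, a₃ ∈ ends e → e = f)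
    (h32 : a₃ ≠ a₂) {a₁ : V} (h31 : a₃ ≠ a₁) (X : Set (Config E)) :
    prob p (TEvent ends a₂ a₁ a₃ ∩ X) = 0 := by
  rw [TEvent'_pendant hf hleaf h32 h31, Set.empty_inter, prob_empty]

omit [LinearOrder R] [IsStrictOrderedRing R] in
/-- `P(T′) = 0`. -/
lemma prob_T' (hf : ends f = s(a₃, a₂)) (hleaf : ∀ e, a₃ ∈ ends e → e = f) (h32 : a₃ ≠ a₂)
    {a₁ : V} (h31 : a₃ ≠ a₁) : prob p (TEvent ends a₂ a₁ a₃) = 0 := by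
  rw [TEvent'_pendant hf hleaf h32 h31, prob_empty]

end Atoms

/-! ## The identity and the theorem -/

section Main

variable [Fintype V] [DecidableEq V] (p : E → R) (ends : E → Sym2 V)

/-- The cleared covariance under `Q`: `C(X, Y) = P(Q) P(Q ∩ X ∩ Y) − P(Q ∩ X) P(Q ∩ Y)`. -/
noncomputable def covC (a₁ a₂ : V) (X Y : Set (Config E)) : R :=
  prob p (avoidAll ends a₂ {a₁}) * prob p (avoidAll ends a₂ {a₁} ∩ (X ∩ Y)) -
    prob p (avoidAll ends a₂ {a₁} ∩ X) * prob p (avoidAll ends a₂ {a₁} ∩ Y)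

omit [Fintype V] [DecidableEq V] in
/-- **mine-a's pendant-at-root identity**: with `a₃` a leaf at `a₂` through `f` (`q = p f`),
`Gc = (1 − q) · P(Q) · [2q · C(oL, bL) − 2(1 − q) · C(oH, bL) − 2 · C(oL, bH)]`. -/
theorem Gc_pendant_root {f : E} {a₃ a₂ : V} (hf : ends f = s(a₃, a₂))
    (hleaf : ∀ e, a₃ ∈ ends e → e = f) (h32 : a₃ ≠ a₂) {o a₁ b : V} (h31 : a₃ ≠ a₁)
    (ho : o ≠ a₃) (hb : b ≠ a₃) :
    Gc p ends o a₁ a₂ a₃ b =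
      (1 - p f) * prob p (avoidAll ends a₂ {a₁}) *
        (2 * p f * covC p ends a₁ a₂ (connEvent ends a₁ o) (connEvent ends a₁ b) -
          2 * (1 - p f) * covC p ends a₁ a₂ (connEvent ends a₂ o) (connEvent ends a₁ b) -
          2 * covC p ends a₁ a₂ (connEvent ends a₁ o) (connEvent ends a₂ b)) := by
  have h21 : a₂ ≠ a₃ := Ne.symm h32
  have h13 : a₁ ≠ a₃ := Ne.symm h31
  have c₁o := free_connEvent hf hleaf h32 h13 ho
  have c₂o := free_connEvent hf hleaf h32 h21 ho
  have c₁b := free_connEvent hf hleaf h32 h13 hb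
  have c₂b := free_connEvent hf hleaf h32 h21 hb
  unfold Gc DEF EQbo EQb3 EQb3o EQo EQ3 EQ3o PDb PDbo Do covC
  rw [gap_eq_Q]
  simp only [prob_PD p hf hleaf h32 h31, prob_T p hf hleaf h32 h31, prob_T' p hf hleaf h32 h31,
    prob_T'_inter p hf hleaf h32 h31,
    prob_PD_inter p hf hleaf h32 h31 c₁b, prob_PD_inter p hf hleaf h32 h31 c₂b,
    prob_PD_inter p hf hleaf h32 h31 c₁o, prob_PD_inter p hf hleaf h32 h31 c₂o,
    prob_PD_inter p hf hleaf h32 h31 (c₁o.inter c₁b), prob_PD_inter p hf hleaf h32 h31 (c₂o.inter c₁b),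
    prob_PD_inter p hf hleaf h32 h31 (c₁o.inter c₂b), prob_PD_inter p hf hleaf h32 h31 (c₂o.inter c₂b),
    prob_T_inter p hf hleaf h32 h31 c₁b, prob_T_inter p hf hleaf h32 h31 c₂b,
    prob_T_inter p hf hleaf h32 h31 c₁o, prob_T_inter p hf hleaf h32 h31 c₂o,
    prob_T_inter p hf hleaf h32 h31 (c₁o.inter c₁b), prob_T_inter p hf hleaf h32 h31 (c₂o.inter c₁b),
    prob_T_inter p hf hleaf h32 h31 (c₁o.inter c₂b), prob_T_inter p hf hleaf h32 h31 (c₂o.inter c₂b)]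
  ring

omit [Fintype E] [DecidableEq E] [Fintype V] [DecidableEq V] in
/-- `clusterInEvent` at a principal up-set is a connection event. -/
lemma clusterInEvent_mem (x v : V) :
    clusterInEvent ends x {S : Set V | v ∈ S} = connEvent ends x v := by
  ext ω
  simp [clusterInEvent, connEvent, mem_cluster]

/-- BHK, same cluster: `C(oL, bL) ≥ 0`. -/
lemma covC_same_nonneg (hp : IsProbVec p) (o a₁ a₂ b : V) :
    0 ≤ covC p ends a₁ a₂ (connEvent ends a₁ o) (connEvent ends a₁ b) := by
  have key := bhk_same_cluster_events p hp ends a₁ a₂ (𝓤 := {S : Set V | o ∈ S})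
    (𝓥 := {S : Set V | b ∈ S}) (fun _ _ hST h => hST h) (fun _ _ hST h => hST h)
  rw [clusterInEvent_mem, clusterInEvent_mem, ← avoidAll_eq_compl,
    Set.inter_comm (connEvent ends a₁ o) (avoidAll ends a₂ {a₁}),
    Set.inter_comm (connEvent ends a₁ b) (avoidAll ends a₂ {a₁}),
    Set.inter_comm (connEvent ends a₁ o ∩ connEvent ends a₁ b) (avoidAll ends a₂ {a₁})] at key
  unfold covC
  linarith

/-- BHK 1.3, cross cluster: `C(oH, bL) ≤ 0` and `C(oL, bH) ≤ 0`. -/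
lemma covC_cross_nonpos (hp : IsProbVec p) (o a₁ a₂ b : V) :
    covC p ends a₁ a₂ (connEvent ends a₂ o) (connEvent ends a₁ b) ≤ 0 ∧
      covC p ends a₁ a₂ (connEvent ends a₁ o) (connEvent ends a₂ b) ≤ 0 := by
  constructor
  · have key := bhk_cross_cluster p hp ends a₁ a₂ (𝓤 := {S : Set V | b ∈ S})
      (𝓥 := {S : Set V | o ∈ S}) (fun _ _ hST h => hST h) (fun _ _ hST h => hST h)
    rw [clusterInEvent_mem, clusterInEvent_mem, ← avoidAll_eq_compl,
      Set.inter_comm (connEvent ends a₁ b) (avoidAll ends a₂ {a₁}),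
      Set.inter_comm (connEvent ends a₂ o) (avoidAll ends a₂ {a₁}),
      Set.inter_comm (connEvent ends a₁ b ∩ connEvent ends a₂ o) (avoidAll ends a₂ {a₁}),
      Set.inter_comm (connEvent ends a₁ b) (connEvent ends a₂ o)] at key
    unfold covC
    linarith
  · have key := bhk_cross_cluster p hp ends a₁ a₂ (𝓤 := {S : Set V | o ∈ S})
      (𝓥 := {S : Set V | b ∈ S}) (fun _ _ hST h => hST h) (fun _ _ hST h => hST h)
    rw [clusterInEvent_mem, clusterInEvent_mem, ← avoidAll_eq_compl,
      Set.inter_comm (connEvent ends a₁ o) (avoidAll ends a₂ {a₁}),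
      Set.inter_comm (connEvent ends a₂ b) (avoidAll ends a₂ {a₁}),
      Set.inter_comm (connEvent ends a₁ o ∩ connEvent ends a₂ b) (avoidAll ends a₂ {a₁})] at key
    unfold covC
    linarith

/-- **(HCOV) at a pendant `a₃` attached to the root `a₂`** (mine-a §13 FACT C; the first
`a₃`-dependent theorem of the (HCOV) line): `0 ≤ Gc` for every admissible weight vector. -/
theorem HCov_pendant_root (hp : IsProbVec p) {f : E} {a₃ a₂ : V} (hf : ends f = s(a₃, a₂))
    (hleaf : ∀ e, a₃ ∈ ends e → e = f) (h32 : a₃ ≠ a₂) {o a₁ b : V} (h31 : a₃ ≠ a₁)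
    (ho : o ≠ a₃) (hb : b ≠ a₃) : HCov p ends o a₁ a₂ a₃ b := by
  unfold HCov
  rw [Gc_pendant_root p ends hf hleaf h32 h31 ho hb]
  have h1 := covC_same_nonneg p ends hp o a₁ a₂ b
  obtain ⟨h2, h3⟩ := covC_cross_nonpos p ends hp o a₁ a₂ b
  have hq0 := hp.nonneg f
  have hq1 := sub_nonneg.2 (hp.le_one f)
  have hQ := prob_nonneg hp (avoidAll ends a₂ {a₁})
  refine mul_nonneg (mul_nonneg hq1 hQ) ?_
  have := mul_nonneg (mul_nonneg (by norm_num : (0 : R) ≤ 2) hq0) h1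
  have := mul_nonneg (mul_nonneg (by norm_num : (0 : R) ≤ 2) hq1) (neg_nonneg.2 h2)
  have := mul_nonneg (by norm_num : (0 : R) ≤ 2) (neg_nonneg.2 h3)
  linarith

end Main

end PendantRoot

end Summit.Ventures.PercRepro2
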